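import Mathlib
import HarnessLib
import Summits.AtomisticToContinuum.HydrodynamicLimit.Theses.AthermalClockWard
import Literature.Analysis.FluidPDE.CollisionalTransfer
import Literature.Analysis.FluidPDE.BoltzmannEquation
import Literature.Analysis.FunctionSpaces.TorusCalculus

/-!
# Line `channel-split` for crux `EnergyFluxResponse` (stmt-AtomisticToContinuum-17509, route AthermalClockWard)

Crux-strategist ALTERNATIVE line (does not replace the registered skeleton `Lines/birth.lean`; it
REFINES birth's load-bearing stub J = `stub_meanEnergyCurrentClosure` along the physical structure of the
microscopic energy current and keeps birth's other three stubs VERBATIM, so every proof landed for birth's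
W / S / F is literally a proof of the same-named stub here).

The crux asks `C_N(s) := Cov_{LG_N}(K_N, ⟨e_N(Φ_s z), χ⟩) → s·e'(s) + 2e(s)` uniformly on `[0,t]`,
`e(s) = ∫χE_s`, `e' = derivWithin e [0,T)`. By the Ward identity (W) `C_N = s·w_N + 2V_N` on `(0,t]`, with
`V_N(s) = E⟨e_N(Φ_s z),χ⟩` the mean energy FIELD and `w_N = V_N'` the mean energy CURRENT tested on `χ`.
The microscopic energy current has exactly two channels (Literature, PROVED weak balance law
`HardSphereFlow.energyObservable_sub_eq_torus`): STREAMING `k_N(s) = E[(N+1)⁻¹ energyStreaming χ (Φ_s z)]`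
(the CUBIC velocity moment `Σᵢ Dχ(xᵢ)vᵢ·|vᵢ|²/2`) and COLLISIONAL TRANSFER (its mean rate is `w_N − k_N`).
The Euler energy flux splits accordingly: `d/ds ∫χE_s = ∫ Dχ(u)·ρ(|u|²/2 + 5θ/2) + ∫ Dχ(u)·(p − ρθ)`
(ideal-enthalpy flux = Gaussian third moment, zero heat current; plus excess-pressure work). So J splits as

* `stub_truncatedKineticClosure` (Kt; OPEN, tail-free): for the velocity-TRUNCATED streaming current
  (continuous cutoff `φ_M(v) = max 0 (min 1 (M+1−|v|))`, a bounded continuous one-body observable) the mean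
  converges, uniformly on `[0,t]`, to the Euler ideal-enthalpy flux up to an error `≤ ε` once `M ≥ M₀(ε)`
  (the slack absorbs the explicit Maxwellian tail): LOCAL EQUILIBRIUM IN MEAN FOR ONE BOUNDED ODD
  OBSERVABLE — BoltzmannHypothesis-class, no HighMomentumCutoff exposure;
* `stub_oddCubicTail` (Tl; OPEN): the mean of the streaming current beyond the cutoff is uniformly small:
  `|k_N(s) − k_N^M(s)| ≤ ε` for `M ≥ M₀`, `N ≥ N₀`, `s ∈ [0,t]` — the ONLY place where high velocities enter;
  it is implied (one Cauchy–Schwarz-free domination `|Dχ(x)v|·|v|²·(1−φ_M) ≤ ‖Dχ‖∞|v|³𝟙{|v|>M}`) by the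
  SHARED staffed item `EnergyCurrentTails` (stmt-AtomisticToContinuum-9235, WarmColdDichotomy /
  OneFlightGossipEngine: cubic UI along the flow, uniform in `s ∈ [0,t]`), and is strictly weaker (odd moment);
* `stub_eulerEnergyFluxSplit` (E; PROVABLE NOW, M): for a classical hs-Euler solution
  `derivWithin (s ↦ ∫χE_s) [0,T) s = κ^E(s) + π^E(s)` on `[0,t]` (energy law of `IsHardSphereEulerSolution` +
  differentiation under `∫_{𝕋³}` + integration by parts; `(E+p)u·Dχ = ρ(|u|²/2+5θ/2)Dχ(u) + (p−ρθ)Dχ(u)`);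
* `stub_collisionalRateClosure` (C; OPEN, load-bearing with Kt): the mean energy field is differentiable on
  `(0,t]` at each `N` (from W) and the mean COLLISIONAL energy-transfer rate `w_N − k_N` converges uniformly
  on `(0,t]` to the excess-pressure work `π^E(s) = ∫ Dχ(u)(p − ρθ)` — Stosszahlansatz IN MEAN for the
  energy-transfer kernel at contact (contact virial; Spohn 1991 (3.15)–(3.17)), the contact-statistics core
  shared with `CollisionalTransferLocality` (stmt-9518) / the collisional stub of `EnergyFluxLocality` (13369).

Composition `EnergyFluxResponse_of (W) (S) (F) (Kt) (Tl) (E) (C)`: thresholds by `min`; `k_N → κ^E`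
uniformly on `[0,t]` (ε/2 from Kt + Tl, `tendstoUniformlyOn_of_trunc`); `s·w_N → s·e'` uniformly on `[0,t]`
(`tendstoUniformlyOn_weighted_current`, using E on `(0,t]`, trivial at `s = 0`); then the Ward calculus of
birth (`tendstoUniformlyOn_of_ward`: product rule + `HasDerivAt.unique` give `C_N = s·w_N + 2V_N` on `(0,t]`,
S at `s = 0`, F for the zeroth order). Kernel-checked, sorries only in the seven `Holds.stub_*`.
Logical status: given W, S and the balance law, Kt ∧ Tl ∧ E ∧ C ⇒ J and F ∧ J ⇔ crux; the split is slightly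
STRONGER than J (J controls only the sum of the two channels and needs only the odd tail of their sum).
-/

noncomputable section

namespace Summit.AtomisticToContinuum.HydrodynamicLimit.Cruxes.EnergyFluxResponse.ChannelSplit

open scoped BigOperators Topology InnerProductSpace
open Filter Set MeasureTheory

/-! ## The stubs (sorried theorems in `Holds`, statements by name below, composition `_of`) -/

namespace Holds

/-- **Stub W — WARD IDENTITY, ENERGY CLAUSE, finite `N`** (VERBATIM birth's `stub_wardEnergy` = third conjunct of
the route support `AthermalClockWard.WardIdentity`, stmt-AtomisticToContinuum-11931): `s ↦ s²·E_P⟨e_N(Φ_s z),χ⟩` has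
derivative `t·Cov_P(K, ⟨e_N(Φ_t ·),χ⟩)` at `t > 0`. Athermality (`IsHardSphereTrajectory.timeDilate`) + Gaussian
change of variables = exponential family in the dilation parameter `c`; differentiate at `c = 1` under `∫`.
Provable now, size M–L. -/
theorem stub_wardEnergy :
    ∀ (σ t : ℝ), 0 < σ → 0 < t → ∀ (a₀ θ₀ : Literature.MathematicalPhysics.KineticTheory.T3 → ℝ) (u₀ : Literature.MathematicalPhysics.KineticTheory.T3 → Literature.MathematicalPhysics.KineticTheory.V3), Continuous a₀ → Continuous θ₀ → Continuous u₀ → (∀ x, 0 < a₀ x) → (∀ x, 0 < θ₀ x) → ∀ (N : ℕ) (Φ : Literature.Analysis.FluidPDE.HardSphereFlow (Literature.Analysis.FluidPDE.Torus.geometry (Fin 3)) (Literature.MathematicalPhysics.KineticTheory.hsDiameter σ N) (N + 1)) (χ : Literature.MathematicalPhysics.KineticTheory.T3 → ℝ), Continuous χ → HasDerivAt (fun s : ℝ => s ^ 2 * ∫ z, Literature.MathematicalPhysics.KineticTheory.empiricalEnergyField (Φ.flow s z) χ ∂(Literature.MathematicalPhysics.KineticTheory.localGibbsLaw σ a₀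 u₀ θ₀ N Φ)) (t * ProbabilityTheory.covariance (fun z : Literature.Analysis.FluidPDE.Config (N + 1) (Fin 3) Literature.MathematicalPhysics.KineticTheory.T3 => ∑ i, ((‖(z i).2‖ ^ 2 - ⟪(z i).2, u₀ (z i).1⟫_ℝ) / θ₀ (z i).1 - 3)) (fun z => Literature.MathematicalPhysics.KineticTheory.empiricalEnergyField (Φ.flow t z) χ) (Literature.MathematicalPhysics.KineticTheory.localGibbsLaw σ a₀ u₀ θ₀ N Φ)) t := by
  sorry

/-- **Stub S — STATIC ENERGY DIRECTION `s = 0`** (VERBATIM birth's `stub_staticEnergyDirection`): under the `t = 0`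
law of large numbers `Cov_{P_N}(K_N, ⟨e_N(Φ_0 z),χ⟩) → 2∫χE₀` (conditionally Gaussian velocities:
`Cov(κ_i, |v_i|²/2 | x_i) = |u₀|² + 3θ₀`, so the covariance equals `E⟨n_N, χ(|u₀|²+3θ₀)⟩` at each `N`).
Provable now, size M. -/
theorem stub_staticEnergyDirection :
    ∀ (a₀ θ₀ : Literature.MathematicalPhysics.KineticTheory.T3 → ℝ) (u₀ : Literature.MathematicalPhysics.KineticTheory.T3 → Literature.MathematicalPhysics.KineticTheory.V3), Continuous a₀ → Continuous θ₀ → Continuous u₀ → (∀ x, 0 < a₀ x) → (∀ x, 0 < θ₀ x) → ∃ σ₀ : ℝ, 0 < σ₀ ∧ ∀ σ : ℝ, 0 < σ → σ < σ₀ → ∀ (ρ θ : ℝ → Literature.MathematicalPhysics.KineticTheory.T3 → ℝ) (u : ℝ → Literature.MathematicalPhysics.KineticTheory.T3 → Literature.MathematicalPhysics.KineticTheory.V3) (Φ : (N : ℕ) → Literature.Analysis.FluidPDE.HardSphereFlow (Literature.Analysis.FluidPDE.Torus.geometry (Fin 3)) (Literature.MathematicalPhysics.KineticTheory.hsDiameter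 σ N) (N + 1)), Literature.MathematicalPhysics.KineticTheory.TendstoHydroFieldsAt (fun N => Literature.MathematicalPhysics.KineticTheory.localGibbsLaw σ a₀ u₀ θ₀ N (Φ N)) Φ ρ u θ 0 → ∀ χ : Literature.MathematicalPhysics.KineticTheory.T3 → ℝ, Continuous χ → Filter.Tendsto (fun N : ℕ => ProbabilityTheory.covariance (fun z : Literature.Analysis.FluidPDE.Config (N + 1) (Fin 3) Literature.MathematicalPhysics.KineticTheory.T3 => ∑ i, ((‖(z i).2‖ ^ 2 - ⟪(z i).2, u₀ (z i).1⟫_ℝ) / θ₀ (z i).1 - 3)) (fun z => Literature.MathematicalPhysics.KineticTheory.empiricalEnergyField ((Φ N).flow 0 z) χ) (Literature.MathematicalPhysics.KineticTheory.localGibbsLaw σ a₀ u₀ θ₀ N (Φ N))) Filter.atTop (nhds (2 * ∫ x, χ x * Literature.MathematicalPhysics.KineticTheory.totalEnergyDensity (ρ 0 x) (u 0 x) (θ 0 x))) := by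
  sorry

/-- **Stub F — MEAN ENERGY FIELD FOLLOWS EULER, UNIFORMLY IN TIME** (VERBATIM birth's `stub_meanEnergyField`):
with the crux prefix, `E_{LG_N}⟨e_N(Φ_s z),χ⟩ → ∫χE_s` uniformly in `s ∈ [0,t]`. Open (the energy clause of the
mean hydrodynamic limit, uniform before the shock; implied by the crux + W by one integration). -/
theorem stub_meanEnergyField :
    ∃ η : ℝ, 0 < η ∧ ∀ (a₀ θ₀ : Literature.MathematicalPhysics.KineticTheory.T3 → ℝ) (u₀ : Literature.MathematicalPhysics.KineticTheory.T3 → Literature.MathematicalPhysics.KineticTheory.V3), Continuous a₀ → Continuous θ₀ → Continuous u₀ → (∀ x, 0 < a₀ x) → (∀ x, 0 < θ₀ x) → ∃ σ₀ : ℝ, 0 < σ₀ ∧ ∀ σ : ℝ, 0 < σ → σ < σ₀ → ∀ (T : ℝ) (ρ θ : ℝ → Literature.MathematicalPhysics.KineticTheory.T3 → ℝ) (u : ℝ → Literature.MathematicalPhysics.KineticTheory.T3 → Literature.MathematicalPhysics.KineticTheory.V3), Literature.MathematicalPhysics.KineticTheory.IsHardSphereEulerSolution σ T ρ u θ → (∀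 t ∈ Set.Ico 0 T, ∀ x, ρ t x * σ ^ 3 < η) → ∀ Φ : (N : ℕ) → Literature.Analysis.FluidPDE.HardSphereFlow (Literature.Analysis.FluidPDE.Torus.geometry (Fin 3)) (Literature.MathematicalPhysics.KineticTheory.hsDiameter σ N) (N + 1), Literature.MathematicalPhysics.KineticTheory.TendstoHydroFieldsAt (fun N => Literature.MathematicalPhysics.KineticTheory.localGibbsLaw σ a₀ u₀ θ₀ N (Φ N)) Φ ρ u θ 0 → ∀ t ∈ Set.Ico 0 T, ∀ χ : Literature.MathematicalPhysics.KineticTheory.T3 → ℝ, Literature.Analysis.FunctionSpaces.Torus.IsSmooth χ → TendstoUniformlyOn (fun (N : ℕ) (s : ℝ) => ∫ z, Literature.MathematicalPhysics.KineticTheory.empiricalEnergyField ((Φ N).flow s z) χ ∂(Literature.MathematicalPhysics.KineticTheory.localGibbsLaw σ a₀ u₀ θ₀ N (Φ N))) (fun s => ∫ x, χ x * Literature.MathematicalPhysics.KineticTheory.totalEnergyDensity (ρ s x) (u s x) (θ s x)) Filter.atTop (Set.Icc 0 t) := by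
  sorry

/-- **Stub Kt — TRUNCATED KINETIC (STREAMING) CLOSURE IN MEAN, up to the Maxwellian tail** (OPEN; tail-free).
With the crux prefix, for every `ε > 0` there is a cutoff level `M₀` such that for every `M ≥ M₀`, eventually in
`N` and uniformly in `s ∈ [0,t]`, the MEAN of the velocity-truncated streaming energy current
`(N+1)⁻¹ Σᵢ Dχ(xᵢ(s))(vᵢ(s))·|vᵢ(s)|²/2·φ_M(vᵢ(s))`, `φ_M(v) = max 0 (min 1 (M+1−|v|))` (a bounded continuous
one-body observable), is within `ε` of the Euler ideal-enthalpy flux `κ^E(s) = ∫ Dχ(x)(u_s)·ρ_s(|u_s|²/2 + 5θ_s/2)`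
(the local-Maxwellian third moment; its own `φ_M`-tail is `< ε/2` for `M ≥ M₀` uniformly on `[0,t] × 𝕋³` by
continuity of `(ρ,u,θ)` and Gaussian decay). Content: LOCAL EQUILIBRIUM IN MEAN for one bounded ODD velocity
observable along the true flow — the kinetic half of the Euler-order closure "heat current q = 0"
(Spohn 1991 §3.2 (3.14), (3.17)) with the tails cut away; an expectation of a bounded statistic, so it follows
by the entropy inequality from `KL(f_N(s) | LG[ρ_s,u_s,θ_s]) = o(N)` (which the tree derives from the three
MEAN fields at time `s`, `tendsto_klDiv_div_of_means`) — no HighMomentumCutoff exposure. Why it might fail: an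
`N`-independent anisotropy / skewness of the bounded-velocity part of the one-body law in mean (Euler-order heat
current carried by thermal particles) at fixed small `σ` before the shock. -/
theorem stub_truncatedKineticClosure :
    ∃ η : ℝ, 0 < η ∧ ∀ (a₀ θ₀ : Literature.MathematicalPhysics.KineticTheory.T3 → ℝ) (u₀ : Literature.MathematicalPhysics.KineticTheory.T3 → Literature.MathematicalPhysics.KineticTheory.V3), Continuous a₀ → Continuous θ₀ → Continuous u₀ → (∀ x, 0 < a₀ x) → (∀ x, 0 < θ₀ x) → ∃ σ₀ : ℝ, 0 < σ₀ ∧ ∀ σ : ℝ, 0 < σ → σ < σ₀ → ∀ (T : ℝ) (ρ θ : ℝ → Literature.MathematicalPhysics.KineticTheory.T3 → ℝ) (u : ℝ → Literature.MathematicalPhysics.KineticTheory.T3 → Literature.MathematicalPhysics.KineticTheory.V3), Literature.MathematicalPhysics.KineticTheory.IsHardSphereEulerSolution σ T ρ u θ → (∀ t ∈ Set.Ico 0 T, ∀ x, ρ t x * σ ^ 3 < η) → ∀ Φ : (N : ℕ) → Literature.Analysis.FluidPDE.HardSphereFlow (Literature.Analysis.FluidPDE.Torus.geometry (Fin 3))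 (Literature.MathematicalPhysics.KineticTheory.hsDiameter σ N) (N + 1), Literature.MathematicalPhysics.KineticTheory.TendstoHydroFieldsAt (fun N => Literature.MathematicalPhysics.KineticTheory.localGibbsLaw σ a₀ u₀ θ₀ N (Φ N)) Φ ρ u θ 0 → ∀ t ∈ Set.Ico 0 T, ∀ χ : Literature.MathematicalPhysics.KineticTheory.T3 → ℝ, Literature.Analysis.FunctionSpaces.Torus.IsSmooth χ → ∀ ε : ℝ, 0 < ε → ∃ M₀ : ℝ, ∀ M : ℝ, M₀ ≤ M → ∃ N₀ : ℕ, ∀ N : ℕ, N₀ ≤ N → ∀ s ∈ Set.Icc 0 t, |(∫ z, (((N : ℝ) + 1)⁻¹ * ∑ i, Literature.Analysis.FunctionSpaces.Torus.fderiv χ (((Φ N).flow s z) i).1 (((Φ N).flow s z) i).2 * (‖(((Φ N).flow s z) i).2‖ ^ 2 / 2) * max 0 (min 1 (M + 1 - ‖(((Φ N).flow s z) i).2‖))) ∂(Literature.MathematicalPhysics.KineticTheory.localGibbsLaw σ a₀ u₀ θ₀ N (Φ N))) - ∫ x, Literature.Analysis.FunctionSpaces.Torus.fderiv χ x (u s x)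 * (ρ s x * (‖u s x‖ ^ 2 / 2 + 5 / 2 * θ s x))| ≤ ε := by
  sorry

/-- **Stub Tl — ODD CUBIC TAIL OF THE MEAN STREAMING CURRENT** (OPEN; the only high-velocity statement of the line).
With the crux prefix, for every `ε > 0` there are `M₀`, `N₀` such that for all `M ≥ M₀`, `N ≥ N₀`, `s ∈ [0,t]` the
mean of the streaming energy current `(N+1)⁻¹ energyStreaming χ = (N+1)⁻¹ Σᵢ Dχ(xᵢ)(vᵢ)|vᵢ|²/2` and the mean of its
`φ_M`-truncation differ by at most `ε`. Since `|Dχ(x)(v)|·|v|²/2·(1 − φ_M(v)) ≤ ‖Dχ‖_∞ |v|³ 𝟙{|v| > M}/2`, it is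
implied by the SHARED item `EnergyCurrentTails` (stmt-AtomisticToContinuum-9235; cubic uniform integrability in
the mean along the flow, uniform on `[0,t]`; leads and a typed split RF₂ ∧ SD ∧ S2a″ exist) and is strictly
weaker (only the ODD tail moment must vanish: an isotropic fast population is harmless here). Why it might fail:
a DIRECTED energy cascade in mean — a vanishing fraction of spheres accelerated anisotropically (jets / wakes
aligned with `∇θ`) carrying an `O(1)` share of the χ-tested energy flux at fixed small `σ`. -/
theorem stub_oddCubicTail :
    ∃ η : ℝ, 0 < η ∧ ∀ (a₀ θ₀ : Literature.MathematicalPhysics.KineticTheory.T3 → ℝ) (u₀ : Literature.MathematicalPhysics.KineticTheory.T3 → Literature.MathematicalPhysics.KineticTheory.V3), Continuous a₀ → Continuous θ₀ → Continuous u₀ → (∀ x, 0 < a₀ x) → (∀ x, 0 < θ₀ x) → ∃ σ₀ : ℝ, 0 < σ₀ ∧ ∀ σ : ℝ, 0 < σ → σ < σ₀ → ∀ (T : ℝ) (ρ θ : ℝ → Literature.MathematicalPhysics.KineticTheory.T3 → ℝ) (u : ℝ → Literature.MathematicalPhysics.KineticTheory.T3 → Literature.MathematicalPhysics.KineticTheory.V3),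 Literature.MathematicalPhysics.KineticTheory.IsHardSphereEulerSolution σ T ρ u θ → (∀ t ∈ Set.Ico 0 T, ∀ x, ρ t x * σ ^ 3 < η) → ∀ Φ : (N : ℕ) → Literature.Analysis.FluidPDE.HardSphereFlow (Literature.Analysis.FluidPDE.Torus.geometry (Fin 3)) (Literature.MathematicalPhysics.KineticTheory.hsDiameter σ N) (N + 1), Literature.MathematicalPhysics.KineticTheory.TendstoHydroFieldsAt (fun N => Literature.MathematicalPhysics.KineticTheory.localGibbsLaw σ a₀ u₀ θ₀ N (Φ N)) Φ ρ u θ 0 → ∀ t ∈ Set.Ico 0 T, ∀ χ : Literature.MathematicalPhysics.KineticTheory.T3 → ℝ, Literature.Analysis.FunctionSpaces.Torus.IsSmooth χ → ∀ ε : ℝ, 0 < ε → ∃ M₀ : ℝ, ∃ N₀ : ℕ, ∀ M : ℝ, M₀ ≤ M → ∀ N : ℕ, N₀ ≤ N → ∀ s ∈ Set.Icc 0 t, |(∫ z, ((N : ℝ) + 1)⁻¹ * Literature.Analysis.FluidPDE.energyStreaming χ ((Φ N).flow s z) ∂(Literature.MathematicalPhysics.KineticTheory.localGibbsLaw σ a₀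 u₀ θ₀ N (Φ N))) - ∫ z, (((N : ℝ) + 1)⁻¹ * ∑ i, Literature.Analysis.FunctionSpaces.Torus.fderiv χ (((Φ N).flow s z) i).1 (((Φ N).flow s z) i).2 * (‖(((Φ N).flow s z) i).2‖ ^ 2 / 2) * max 0 (min 1 (M + 1 - ‖(((Φ N).flow s z) i).2‖))) ∂(Literature.MathematicalPhysics.KineticTheory.localGibbsLaw σ a₀ u₀ θ₀ N (Φ N))| ≤ ε := by
  sorry

/-- **Stub E — EULER ENERGY-FLUX SPLIT of the target derivative** (PROVABLE NOW, size M; pure PDE calculus).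
For a classical hard-sphere Euler solution on `[0,T)`, `t < T`, smooth `χ` and `s ∈ [0,t]`:
`derivWithin (s ↦ ∫χE_s) [0,T) s = ∫ Dχ(x)(u_s)·ρ_s(|u_s|²/2 + 5θ_s/2) + ∫ Dχ(x)(u_s)·(p(ρ_s,θ_s) − ρ_sθ_s)`:
the energy law `∂ₜE + div((E+p)u) = 0` of `IsHardSphereEulerSolution` (pointwise, `timeDerivWithin [0,T)`),
differentiation under `∫_{𝕋³}` (joint smoothness `IsSmoothSpaceTimeOn`; cf. `hasDerivWithinAt_integral_mul_slice`),
integration by parts on the torus, and the pointwise identity `(E + p) = ρ(|u|²/2 + 5θ/2) + (p − ρθ)`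
(`totalEnergyDensity`). Ideal-enthalpy (kinetic) flux + excess-pressure work (collisional flux),
Spohn 1991 §3.2 (3.17), Chapman–Cowling §16.4. -/
theorem stub_eulerEnergyFluxSplit :
    ∀ (σ T : ℝ) (ρ θ : ℝ → Literature.MathematicalPhysics.KineticTheory.T3 → ℝ) (u : ℝ → Literature.MathematicalPhysics.KineticTheory.T3 → Literature.MathematicalPhysics.KineticTheory.V3), Literature.MathematicalPhysics.KineticTheory.IsHardSphereEulerSolution σ T ρ u θ → ∀ t ∈ Set.Ico 0 T, ∀ χ : Literature.MathematicalPhysics.KineticTheory.T3 → ℝ, Literature.Analysis.FunctionSpaces.Torus.IsSmooth χ → ∀ s ∈ Set.Icc 0 t, derivWithin (fun s' => ∫ x, χ x * Literature.MathematicalPhysics.KineticTheory.totalEnergyDensity (ρ s' x) (u s' x) (θ s' x)) (Set.Ico 0 T) s = (∫ x, Literature.Analysis.FunctionSpaces.Torus.fderiv χ x (u s x) * (ρ s x * (‖u s x‖ ^ 2 / 2 + 5 / 2 * θ s x))) + ∫ x, Literature.Analysis.FunctionSpaces.Torus.fderiv χ x (u s x) * (Literature.MathematicalPhysics.KineticTheory.hsPressure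 σ (ρ s x) (θ s x) - ρ s x * θ s x) := by
  sorry

/-- **Stub C — COLLISIONAL ENERGY-TRANSFER RATE CLOSURE IN MEAN** (OPEN; load-bearing together with Kt).
With the crux prefix: (i) at every `N` the mean energy field `s ↦ V_N(s) = E_{LG_N}⟨e_N(Φ_s z),χ⟩` is differentiable
at each `s ∈ (0,t]`, derivative `w_N(s)` (follows from W: `V_N = s⁻²·(s²V_N)`); (ii) the mean COLLISIONAL
energy-transfer rate `w_N(s) − k_N(s)` — by the weak energy balance law in mean
(`HardSphereFlow.energyObservable_sub_eq_torus`: field increment = ∫ streaming + collisional transfer) it is the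
`s`-derivative of `E[(N+1)⁻¹ energyTransfer χ z s]`, i.e. the mean over collisions in `ds` of
`(N+1)⁻¹(χ(xᵢ) − χ(xⱼ))·Δ(|vᵢ|²/2)` — converges UNIFORMLY on `(0,t]` to the excess-pressure work
`π^E(s) = ∫ Dχ(x)(u_s)·(p(ρ_s,θ_s) − ρ_sθ_s)` (`p − ρθ = ρθ(Z(ρσ³) − 1)`, contact virial: Spohn 1991 (3.15)–(3.17);
the static half — contact value of the local Gibbs pair correlation ↔ `Z` — is the PROVED `HardSphereContactTheorem`
used by stmt-9518). Content: STOSSZAHLANSATZ IN MEAN for the energy-transfer kernel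
`(v_rel·n)₊·(V_cm·n)(v_rel·n)` at contact, along the true flow, at EVERY time (a rate, not a time average):
the contact-statistics core. Why it might fail: (a) an `N`-independent correlation at contact between the
centre-of-mass normal velocity and the collision rate (pre-collisional alignment in compressing regions) —
collisional heat flux at Euler order; (b) the energy-weighted collision intensity of fast spheres not uniformly
integrable (the collisional twin of Tl; cf. `EnergyFluxCeilingWindows`, OneFlightGossipEngine); (c) kinetic-frequency
oscillation of the mean transfer rate (uniformity / pointwise-in-`s` convergence of a RATE). -/
theorem stub_collisionalRateClosure :
    ∃ η : ℝ, 0 < η ∧ ∀ (a₀ θ₀ : Literature.MathematicalPhysics.KineticTheory.T3 → ℝ) (u₀ : Literature.MathematicalPhysics.KineticTheory.T3 → Literature.MathematicalPhysics.KineticTheory.V3), Continuous a₀ → Continuous θ₀ → Continuous u₀ → (∀ x, 0 < a₀ x) → (∀ x, 0 < θ₀ x) → ∃ σ₀ : ℝ, 0 < σ₀ ∧ ∀ σ : ℝ, 0 < σ → σ < σ₀ → ∀ (T : ℝ) (ρ θ : ℝ → Literature.MathematicalPhysics.KineticTheory.T3 → ℝ) (u : ℝ → Literature.MathematicalPhysics.KineticTheory.T3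 → Literature.MathematicalPhysics.KineticTheory.V3), Literature.MathematicalPhysics.KineticTheory.IsHardSphereEulerSolution σ T ρ u θ → (∀ t ∈ Set.Ico 0 T, ∀ x, ρ t x * σ ^ 3 < η) → ∀ Φ : (N : ℕ) → Literature.Analysis.FluidPDE.HardSphereFlow (Literature.Analysis.FluidPDE.Torus.geometry (Fin 3)) (Literature.MathematicalPhysics.KineticTheory.hsDiameter σ N) (N + 1), Literature.MathematicalPhysics.KineticTheory.TendstoHydroFieldsAt (fun N => Literature.MathematicalPhysics.KineticTheory.localGibbsLaw σ a₀ u₀ θ₀ N (Φ N)) Φ ρ u θ 0 → ∀ t ∈ Set.Ico 0 T, ∀ χ : Literature.MathematicalPhysics.KineticTheory.T3 → ℝ, Literature.Analysis.FunctionSpaces.Torus.IsSmooth χ → ∃ w : ℕ → ℝ → ℝ, (∀ N : ℕ, ∀ s ∈ Set.Ioc 0 t, HasDerivAt (fun r : ℝ => ∫ z, Literature.MathematicalPhysics.KineticTheory.empiricalEnergyField ((Φ N).flow r z) χ ∂(Literature.MathematicalPhysics.KineticTheory.localGibbsLaw σ a₀ u₀ θ₀ N (Φ N))) (w N s) s)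 ∧ TendstoUniformlyOn (fun (N : ℕ) (s : ℝ) => w N s - ∫ z, ((N : ℝ) + 1)⁻¹ * Literature.Analysis.FluidPDE.energyStreaming χ ((Φ N).flow s z) ∂(Literature.MathematicalPhysics.KineticTheory.localGibbsLaw σ a₀ u₀ θ₀ N (Φ N))) (fun s => ∫ x, Literature.Analysis.FunctionSpaces.Torus.fderiv χ x (u s x) * (Literature.MathematicalPhysics.KineticTheory.hsPressure σ (ρ s x) (θ s x) - ρ s x * θ s x)) Filter.atTop (Set.Ioc 0 t) := by
  sorry

end Holds

/-! ## The stub statements by name (hypotheses of `EnergyFluxResponse_of`) -/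

/-- Statement of `Holds.stub_wardEnergy` (W). -/
def stub_wardEnergy : Prop := type_of% Holds.stub_wardEnergy
/-- Statement of `Holds.stub_staticEnergyDirection` (S). -/
def stub_staticEnergyDirection : Prop := type_of% Holds.stub_staticEnergyDirection
/-- Statement of `Holds.stub_meanEnergyField` (F). -/
def stub_meanEnergyField : Prop := type_of% Holds.stub_meanEnergyField
/-- Statement of `Holds.stub_truncatedKineticClosure` (Kt). -/
def stub_truncatedKineticClosure : Prop := type_of% Holds.stub_truncatedKineticClosure
/-- Statement of `Holds.stub_oddCubicTail` (Tl). -/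
def stub_oddCubicTail : Prop := type_of% Holds.stub_oddCubicTail
/-- Statement of `Holds.stub_eulerEnergyFluxSplit` (E). -/
def stub_eulerEnergyFluxSplit : Prop := type_of% Holds.stub_eulerEnergyFluxSplit
/-- Statement of `Holds.stub_collisionalRateClosure` (C). -/
def stub_collisionalRateClosure : Prop := type_of% Holds.stub_collisionalRateClosure

/-! ## Proved glue (pure one-variable analysis, kernel-checked) -/

/-- **Ward assembly, abstract form** (as in line `birth`): Ward product rule on `(0,t]`, current + field +
static direction ⇒ the covariance converges uniformly on `[0,t]`. -/
theorem tendstoUniformlyOn_of_ward {t : ℝ} {C V w : ℕ → ℝ → ℝ} {e e' : ℝ → ℝ}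
    (hW : ∀ N : ℕ, ∀ s ∈ Set.Ioc 0 t, HasDerivAt (fun r : ℝ => r ^ 2 * V N r) (s * C N s) s)
    (hS : Tendsto (fun N : ℕ => C N 0) atTop (𝓝 (2 * e 0)))
    (hF : TendstoUniformlyOn V e atTop (Set.Icc 0 t))
    (hJ₁ : ∀ N : ℕ, ∀ s ∈ Set.Ioc 0 t, HasDerivAt (V N) (w N s) s)
    (hJ₂ : TendstoUniformlyOn (fun (N : ℕ) (s : ℝ) => s * w N s) (fun s => s * e' s) atTop (Set.Icc 0 t)) :
    TendstoUniformlyOn C (fun s => s * e' s + 2 * e s) atTop (Set.Icc 0 t) := by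
  have hC : ∀ N : ℕ, ∀ s ∈ Set.Ioc 0 t, C N s = s * w N s + 2 * V N s := by
    intro N s hs
    have hpow : HasDerivAt (fun r : ℝ => r ^ 2) (2 * s) s := by
      simpa using hasDerivAt_pow 2 s
    have hprod : HasDerivAt (fun r : ℝ => r ^ 2 * V N r) (2 * s * V N s + s ^ 2 * w N s) s :=
      hpow.mul (hJ₁ N s hs)
    have hid : s * C N s = 2 * s * V N s + s ^ 2 * w N s := (hW N s hs).unique hprod
    have hs0 : s ≠ 0 := hs.1.ne'
    have h' : s * C N s = s * (s * w N s + 2 * V N s) := by rw [hid]; ring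
    exact mul_left_cancel₀ hs0 h'
  rw [Metric.tendstoUniformlyOn_iff] at hF hJ₂ ⊢
  intro ε hε
  have hε2 : 0 < ε / 2 := half_pos hε
  have hε4 : 0 < ε / 4 := by positivity
  filter_upwards [Metric.tendsto_nhds.1 hS ε hε, hF (ε / 4) hε4, hJ₂ (ε / 2) hε2] with N hN0 hNF hNJ
  intro s hs
  rcases eq_or_lt_of_le hs.1 with h0 | hpos
  · subst h0
    rw [zero_mul, zero_add, dist_comm]
    exact hN0
  · rw [hC N s ⟨hpos, hs.2⟩]
    have h2 : dist (2 * e s) (2 * V N s) = 2 * dist (e s) (V N s) := by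
      rw [Real.dist_eq, Real.dist_eq, ← mul_sub, abs_mul, abs_two]
    calc dist (s * e' s + 2 * e s) (s * w N s + 2 * V N s)
        ≤ dist (s * e' s) (s * w N s) + dist (2 * e s) (2 * V N s) := dist_add_add_le _ _ _ _
      _ < ε / 2 + 2 * (ε / 4) := by
          rw [h2]
          exact add_lt_add (hNJ s hs) (by linarith [hNF s hs])
      _ = ε := by ring

/-- **Truncation assembly**: if the truncated means `kM M N` are within `ε` of `κ` for `M ≥ M₀(ε)` eventually in
`N` (uniformly on `S`), and the full means `k N` are within `ε` of the truncated ones for `M ≥ M₀'(ε)`,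
`N ≥ N₀'(ε)` (uniformly on `S`), then `k N → κ` uniformly on `S`. -/
theorem tendstoUniformlyOn_of_trunc {S : Set ℝ} {k : ℕ → ℝ → ℝ} {kM : ℝ → ℕ → ℝ → ℝ} {κ : ℝ → ℝ}
    (hK : ∀ ε : ℝ, 0 < ε → ∃ M₀ : ℝ, ∀ M : ℝ, M₀ ≤ M → ∃ N₀ : ℕ, ∀ N : ℕ, N₀ ≤ N → ∀ s ∈ S,
      |kM M N s - κ s| ≤ ε)
    (hT : ∀ ε : ℝ, 0 < ε → ∃ M₀ : ℝ, ∃ N₀ : ℕ, ∀ M : ℝ, M₀ ≤ M → ∀ N : ℕ, N₀ ≤ N → ∀ s ∈ S,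
      |k N s - kM M N s| ≤ ε) :
    TendstoUniformlyOn k κ atTop S := by
  rw [Metric.tendstoUniformlyOn_iff]
  intro ε hε
  have hε3 : 0 < ε / 3 := by positivity
  obtain ⟨M₁, hM₁⟩ := hK (ε / 3) hε3
  obtain ⟨M₂, N₂, hM₂⟩ := hT (ε / 3) hε3
  obtain ⟨N₁, hN₁⟩ := hM₁ (max M₁ M₂) (le_max_left _ _)
  filter_upwards [eventually_ge_atTop (max N₁ N₂)] with N hN
  intro s hs
  have h1 : |kM (max M₁ M₂) N s - κ s| ≤ ε / 3 := hN₁ N ((le_max_left _ _).trans hN) s hs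
  have h2 : |k N s - kM (max M₁ M₂) N s| ≤ ε / 3 :=
    hM₂ (max M₁ M₂) (le_max_right _ _) N ((le_max_right _ _).trans hN) s hs
  rw [Real.dist_eq]
  calc |κ s - k N s| = |(kM (max M₁ M₂) N s - κ s) + (k N s - kM (max M₁ M₂) N s)| := by
        rw [abs_sub_comm]; congr 1; ring
    _ ≤ |kM (max M₁ M₂) N s - κ s| + |k N s - kM (max M₁ M₂) N s| := abs_add_le _ _
    _ ≤ ε / 3 + ε / 3 := add_le_add h1 h2
    _ < ε := by linarith

/-- **Current assembly**: the kinetic channel converges uniformly on `[0,t]`, the collisional channel (`w − k`)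
uniformly on `(0,t]`, and the target derivative splits as `d = κ + π` on `[0,t]`; then the weighted current
`s·w N s → s·d s` uniformly on `[0,t]` (the weight kills `s = 0`). -/
theorem tendstoUniformlyOn_weighted_current {t : ℝ} {k w : ℕ → ℝ → ℝ} {κ π d : ℝ → ℝ}
    (hk : TendstoUniformlyOn k κ atTop (Set.Icc 0 t))
    (hc : TendstoUniformlyOn (fun (N : ℕ) (s : ℝ) => w N s - k N s) π atTop (Set.Ioc 0 t))
    (hd : ∀ s ∈ Set.Icc 0 t, d s = κ s + π s) :
    TendstoUniformlyOn (fun (N : ℕ) (s : ℝ) => s * w N s) (fun s => s * d s) atTop (Set.Icc 0 t) := by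
  rw [Metric.tendstoUniformlyOn_iff] at hk hc ⊢
  intro ε hε
  have ht1 : 0 < |t| + 1 := by positivity
  have hε' : 0 < ε / (2 * (|t| + 1)) := by positivity
  filter_upwards [hk _ hε', hc _ hε'] with N hNk hNc
  intro s hs
  rcases eq_or_lt_of_le hs.1 with h0 | hpos
  · subst h0
    simpa using hε
  · have hs' : s ∈ Set.Ioc 0 t := ⟨hpos, hs.2⟩
    have e1 := hNk s hs
    have e2 := hNc s hs'
    rw [Real.dist_eq] at e1 e2 ⊢
    have hst : |s| ≤ |t| := by
      rw [abs_of_pos hpos]; exact hs.2.trans (le_abs_self t)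
    have hsum : |d s - w N s| < ε / (|t| + 1) := by
      have : d s - w N s = (κ s - k N s) + (π s - (w N s - k N s)) := by rw [hd s hs]; ring
      rw [this]
      calc |(κ s - k N s) + (π s - (w N s - k N s))|
          ≤ |κ s - k N s| + |π s - (w N s - k N s)| := abs_add_le _ _
        _ < ε / (2 * (|t| + 1)) + ε / (2 * (|t| + 1)) := add_lt_add e1 e2
        _ = ε / (|t| + 1) := by field_simp; ring
    calc |s * d s - s * w N s| = |s| * |d s - w N s| := by rw [← mul_sub, abs_mul]
      _ ≤ |t| * (ε / (|t| + 1)) :=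
          mul_le_mul hst hsum.le (abs_nonneg _) (abs_nonneg _)
      _ < ε := by
          rw [mul_div_assoc']
          rw [div_lt_iff₀ ht1]
          nlinarith [abs_nonneg t]

/-! ## Composition: the seven stubs give the crux BY NAME -/

/-- **`W → S → F → Kt → Tl → E → C → EnergyFluxResponse`** (hypotheses = the seven stub statements BY NAME;
kernel-checked). Thresholds `η := min η_F (min η_K (min η_T η_C))`, `σ₀ := min σ_S (min σ_F (min σ_K (min σ_T σ_C)))`;
at the crux data: Kt + Tl ⇒ `k_N → κ^E` uniformly on `[0,t]` (`tendstoUniformlyOn_of_trunc`); with C and E,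
`s·w_N → s·e'` uniformly on `[0,t]` (`tendstoUniformlyOn_weighted_current`); then W, S, F and the Ward calculus
(`tendstoUniformlyOn_of_ward`). -/
theorem EnergyFluxResponse_of (hW : stub_wardEnergy) (hS : stub_staticEnergyDirection)
    (hF : stub_meanEnergyField) (hK : stub_truncatedKineticClosure) (hT : stub_oddCubicTail)
    (hE : stub_eulerEnergyFluxSplit) (hC : stub_collisionalRateClosure) :
    Summit.AtomisticToContinuum.HydrodynamicLimit.Theses.AthermalClockWard.EnergyFluxResponse := by
  have hW' : type_of% Holds.stub_wardEnergy := hW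
  have hS' : type_of% Holds.stub_staticEnergyDirection := hS
  have hF' : type_of% Holds.stub_meanEnergyField := hF
  have hK' : type_of% Holds.stub_truncatedKineticClosure := hK
  have hT' : type_of% Holds.stub_oddCubicTail := hT
  have hE' : type_of% Holds.stub_eulerEnergyFluxSplit := hE
  have hC' : type_of% Holds.stub_collisionalRateClosure := hC
  clear hW hS hF hK hT hE hC
  obtain ⟨ηF, hηF, HF⟩ := hF'
  obtain ⟨ηK, hηK, HK⟩ := hK'
  obtain ⟨ηT, hηT, HT⟩ := hT'
  obtain ⟨ηC, hηC, HC⟩ := hC'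
  refine ⟨min ηF (min ηK (min ηT ηC)), lt_min hηF (lt_min hηK (lt_min hηT hηC)), ?_⟩
  intro a₀ θ₀ u₀ ha hθ hu ha0 hθ0
  obtain ⟨σS, hσS, GS⟩ := hS' a₀ θ₀ u₀ ha hθ hu ha0 hθ0
  obtain ⟨σF, hσF, GF⟩ := HF a₀ θ₀ u₀ ha hθ hu ha0 hθ0
  obtain ⟨σK, hσK, GK⟩ := HK a₀ θ₀ u₀ ha hθ hu ha0 hθ0
  obtain ⟨σT, hσT, GT⟩ := HT a₀ θ₀ u₀ ha hθ hu ha0 hθ0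
  obtain ⟨σC, hσC, GC⟩ := HC a₀ θ₀ u₀ ha hθ hu ha0 hθ0
  refine ⟨min σS (min σF (min σK (min σT σC))),
    lt_min hσS (lt_min hσF (lt_min hσK (lt_min hσT hσC))), ?_⟩
  intro σ hσ hσlt T ρ θ u hsol hpack Φ h0 t ht χ hχ
  -- thresholds
  have hσS' : σ < σS := hσlt.trans_le (min_le_left _ _)
  have hσF' : σ < σF := hσlt.trans_le ((min_le_right _ _).trans (min_le_left _ _))
  have hσK' : σ < σK :=
    hσlt.trans_le ((min_le_right _ _).trans ((min_le_right _ _).trans (min_le_left _ _)))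
  have hσT' : σ < σT := hσlt.trans_le
    ((min_le_right _ _).trans ((min_le_right _ _).trans ((min_le_right _ _).trans (min_le_left _ _))))
  have hσC' : σ < σC := hσlt.trans_le
    ((min_le_right _ _).trans ((min_le_right _ _).trans ((min_le_right _ _).trans (min_le_right _ _))))
  have hpF : ∀ s ∈ Set.Ico 0 T, ∀ x, ρ s x * σ ^ 3 < ηF :=
    fun s hs x => (hpack s hs x).trans_le (min_le_left _ _)
  have hpK : ∀ s ∈ Set.Ico 0 T, ∀ x, ρ s x * σ ^ 3 < ηK :=
    fun s hs x => (hpack s hs x).trans_le ((min_le_right _ _).trans (min_le_left _ _))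
  have hpT : ∀ s ∈ Set.Ico 0 T, ∀ x, ρ s x * σ ^ 3 < ηT :=
    fun s hs x => (hpack s hs x).trans_le
      ((min_le_right _ _).trans ((min_le_right _ _).trans (min_le_left _ _)))
  have hpC : ∀ s ∈ Set.Ico 0 T, ∀ x, ρ s x * σ ^ 3 < ηC :=
    fun s hs x => (hpack s hs x).trans_le
      ((min_le_right _ _).trans ((min_le_right _ _).trans (min_le_right _ _)))
  -- the stubs at the data
  have hS0 := GS σ hσ hσS' ρ θ u Φ h0 χ hχ.continuous
  have hFu := GF σ hσ hσF' T ρ θ u hsol hpF Φ h0 t ht χ hχ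
  have hKu := GK σ hσ hσK' T ρ θ u hsol hpK Φ h0 t ht χ hχ
  have hTu := GT σ hσ hσT' T ρ θ u hsol hpT Φ h0 t ht χ hχ
  obtain ⟨w, hw, hc⟩ := GC σ hσ hσC' T ρ θ u hsol hpC Φ h0 t ht χ hχ
  have hEu := hE' σ T ρ θ u hsol t ht χ hχ
  -- kinetic channel: truncation + odd tail
  have hk : TendstoUniformlyOn
      (fun (N : ℕ) (s : ℝ) => ∫ z, ((N : ℝ) + 1)⁻¹ *
        Literature.Analysis.FluidPDE.energyStreaming χ ((Φ N).flow s z)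
          ∂(Literature.MathematicalPhysics.KineticTheory.localGibbsLaw σ a₀ u₀ θ₀ N (Φ N)))
      (fun s => ∫ x, Literature.Analysis.FunctionSpaces.Torus.fderiv χ x (u s x) *
        (ρ s x * (‖u s x‖ ^ 2 / 2 + 5 / 2 * θ s x))) atTop (Set.Icc 0 t) :=
    tendstoUniformlyOn_of_trunc
      (kM := fun M N s => ∫ z, (((N : ℝ) + 1)⁻¹ * ∑ i,
        Literature.Analysis.FunctionSpaces.Torus.fderiv χ (((Φ N).flow s z) i).1 (((Φ N).flow s z) i).2 *
          (‖(((Φ N).flow s z) i).2‖ ^ 2 / 2) * max 0 (min 1 (M + 1 - ‖(((Φ N).flow s z) i).2‖)))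
        ∂(Literature.MathematicalPhysics.KineticTheory.localGibbsLaw σ a₀ u₀ θ₀ N (Φ N)))
      hKu hTu
  -- both channels, weighted by `s`
  have hJ₂ := tendstoUniformlyOn_weighted_current hk hc hEu
  -- Ward calculus
  refine tendstoUniformlyOn_of_ward ?_ hS0 hFu hw hJ₂
  intro N s hs
  exact hW' σ s hσ hs.1 a₀ θ₀ u₀ ha hθ hu ha0 hθ0 N (Φ N) χ hχ.continuous

end Summit.AtomisticToContinuum.HydrodynamicLimit.Cruxes.EnergyFluxResponse.ChannelSplit

end
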